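import Mathlib
import HarnessLib
import HarnessLib.Audit
import Summits.KontsevichZagierPeriods.Statement

/-!
Route: ExceptionalCouplings

CLOSED (retired) 2026-08-15T13:48:22Z by operator:999:1257524 — reason: not-a-thesis: assembly does not conclude the sub-problem Statement — note: D-0027 §2.1 audit (human 2026-08-15: routes that do not decide the summit are removed): the assembly concludes `ThirdsSector`, not the sub-problem statement; a NEW conforming route may be opened from the same idea (generated `closes : … → _root_.KontsevichZagierPeriods`).. The file is kept as the record of this route; refuted decls are indexed as negative knowledge (`ledger negatives`).

# Route ExceptionalCouplings — the exceptional Macdonald sector of Conjecture 1 — coupling 1/3 on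
one torus (5·G₂ = 6·A₂), shifts as moves, anchors per coset; a G₂ laboratory where only Opdam +
continuation reach

SECTOR ROUTE realising idea card exceptional-couplings-one-third-g2-over-a2 (audited
new-combination), declared up front: the Target is Conjecture 1
RESTRICTED to a sector — the ℤ-span Σ of the G₂ and A₂ Macdonald torus representations at exponents
k ∈ 1/3 + ℕ — a necessary special
case of the summit (support SectorOfSummit : KontsevichZagierPeriods → ThirdsSector, proved in the
planner's Sketch.lean), NOT claimed to imply it;
the Assembly ends in the local Target (precedent: route PhiFourLaboratory). Objects (all in
tan-half-angle coordinates t ∈ ℝ² on the 2-torus,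
e(t) = (1+it)/(1−it) = e^{iθ}, J(t) = 4/((1+t₀²)(1+t₁²)) = dθ/dt, |Δ⁺_R(t)| = Π_{α∈R⁺} ‖1 −
e(t₀)^{a}e(t₁)^{b}‖ over the positive roots
α = aα₁ + bα₂; G₂: (1,0),(0,1),(1,1),(2,1),(3,1),(3,2); its short roots (1,0),(1,1),(2,1) are an A₂
on the SAME torus): the Macdonald–Opdam
integrals I_R(k) = ∫_{ℝ²} J·|Δ⁺_R|^{2k} = (2π)²·Π_i binom(k d_i, k) (Macdonald1982 Conj. / Opdam1989
Thm). It suffices, for Σ, to show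
X := G2OverA2 ∧ ShiftIsMoves: (G2OverA2, the card's headline, rank 2) 5·[ℝ², J·|Δ⁺_{G₂}|^{2/3}] −
6·[ℝ², J·|Δ⁺_{A₂}|^{2/3}] ∈ KZ.relations —
"the three long roots of G₂ are worth exactly one fifth more", a same-torus, dimension-2,
rational-ratio identity whose every proof leaves ℚ̄
(162/(5Γ(1/3)³) = (6/5)·27/Γ(1/3)³); (ShiftIsMoves, the engine, rank 4) the Heckman–Opdam shift k →
k+1 is a finite move chain on the torus for
G₂ and for A₂ at every rational k ≥ 0, in integer-scalar form D̃(p,q)·[k+1] − Ñ(p,q)·[k] ∈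
KZ.relations with Ñ/D̃ = I(k+1)/I(k) ∈ ℚ(k)
(G₂: 144(2k+1)²(3k+1)(3k+2)(6k+1)(6k+5) / 5(k+1)²(5k+1)(5k+2)(5k+3)(5k+4); A₂:
3(3k+1)(3k+2)/(k+1)²). Because every value in Σ is a
positive rational multiple of the single number I_{A₂}(1/3), the sector is RANK ONE over ℚ and X ∧
TorsionFree (P_KZ torsion-free, provable now,
shared with route CoactionDevissage) gives the Target with no transcendence input at all. Two
further ranked cruxes probe the two other cosets
and the wall itself: G2OpdamLine (rank 3) — the whole G₂ exponent line in Beta normal form, one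
typed ∀k statement in dimension 4 with RATIONAL
data f·g^k ~ f·h^k, whose integer points are accessible and whose non-integer points are exactly
what "Opdam + Carlson" alone reach — and
G2HalfRational (rank 5) — the k = 1/2 anchor is the RATIONAL number 512/5, a piecewise-rational
2-dim calibration (alcove/sign-cell dissection).
Lean: `G2OverA2 ∧ ShiftIsMoves`

## Assembly
Rank-one algebra, no transcendence (proof sketch, to be formalised by
AddSubgroup.closure_induction): from ShiftIsMoves at (p,q) = (3j+1,3) get
positive integers with D̃_j·[ρG (j+1)] ≡ Ñ_j·[ρG j] and likewise for ρA (the exponents 2·((3j+1)/3)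
= 2(j+1/3) match after norm_num); from
G2OverA2, 5·[ρG 0] ≡ 6·[ρA 0]; by induction every generator g satisfies P·g ≡ Q·[ρA 0] mod relations
with P > 0, and this predicate is closed
under sums and negatives, so for c in the closure P·c ≡ K·[ρA 0], P > 0, K ∈ ℤ. If KZ.eval c = 0,
soundness (KZ.relations_le_ker_eval_holds)
gives K·value(ρA 0) = 0, and value(ρA 0) = ∫ J·|Δ⁺_{A₂}|^{2/3} > 0 (a.e.-positive integrable
integrand), so K = 0, P·c ∈ relations, and
TorsionFree yields c ∈ relations. The Assembly ends in the LOCAL Target ThirdsSector, not in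
KontsevichZagierPeriods: this is a sector route and says so
(SectorOfSummit records the converse direction summit ⇒ Target).

Rationale: WHY THIS LINE. Mechanism (card): root systems are a source of Conjecture-1 instances with rational
constants and NO known coupling — for A/B/C/D types the
Macdonald integrals reduce to Selberg's (ForresterWarnaar2008 pp. 7–8, read: t = sin²θ; Anderson1991
/ Killip–Nenciu doi:10.1155/s1073792804141597
give genuine changes of variables), but for G₂, F₄, E₆₋₈ at non-integer k the ONLY proof is
Opdam1989 (uniform, hypergeometric shift operators;
Heckman1991 doi:10.1007/bf01239517 elementary construction via Dunkl operators; integer k: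
Zeilberger doi:10.1137/0518065 via Morris n = 3,
Habsieger doi:10.1007/978-1-4684-0637-5_9, Garvan doi:10.1137/0521045, Cherednik
doi:10.2307/2118632), i.e. an accessible-looking recursion in k
plus analytic continuation from the integers — the sharpest form of the "coset wall" (cards
wz-resummation-coset-wall, mellin-exponent-deformation-ibp)
because here BOTH the integer points AND the shifts are accessible. Imported area: harmonic analysis
on root systems (Heckman–Opdam theory, Dunkl
operators, Macdonald's constant-term ex-conjectures) × the KZ rules; the new arithmetic observation
(card (T), re-verified here by Γ-bookkeeping and
by 500² torus quadrature) is that at k = 1/3 all exceptional integrals are RATIONAL multiples of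
powers of the A₂ integral (n₂ = n₀ for G₂, F₄, E₆,
E₇, E₈; q_{G₂} = 6/5 = binom(2,⅓)/binom(1,⅓)), giving typed same-torus pairs with no π and no Γ in
the statement. What the line does that no
existing route does: none of the 20 routes on this summit (Ayoub…ValuedFieldSpecialisation, checked
2026-08-15) touches root-system or
random-matrix integrals; the negatives index is empty; the sector assembly is transcendence-free
(rank one), unlike the MZV sector.

RANKED CRUXES. #0 ThirdsSector (target) — LOCAL TARGET — Conjecture 1 (kernel form) on the sector Σ:
for any families ρG, ρA : ℕ → KZ.IntegralRep 2 with domain ℝ² and integrands J·|Δ⁺_{G₂}|^{2(j+1/3)},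
J·|Δ⁺_{A₂}|^{2(j+1/3)}, every ℤ-combination c of the [ρG j], [ρA j] with KZ.eval c = 0 lies in
KZ.relations. Necessary special case of the summit (SectorOfSummit); does not imply it. (why it
might fail: Local target, false iff the fixed four-move calculus misses one of these Opdam
identities (then the H21-literal summit is false too, SectorOfSummit); it does NOT imply the summit
and is not claimed to.) [KontsevichZagierPeriods2001, Macdonald1982, Opdam1989]
#2 G2OverA2 (crux) — coupling 1/3 on one torus (card item G2OverA2): with r = [ℝ²,
J·|Δ⁺_{G₂}|^{2/3}] and r' = [ℝ², J·|Δ⁺_{A₂}|^{2/3}] (A₂ = the short roots of G₂, same torus), 5·[r]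
− 6·[r'] ∈ KZ.relations (values: 5·(2π)²·162/(5Γ(1/3)³) = 6·(2π)²·27/Γ(1/3)³ ≈ 332.65;
two-representation reading [ℝ², 5J|Δ⁺_{G₂}|^{2/3}] ~ [ℝ², 6J|Δ⁺_{A₂}|^{2/3}] up to four
integrand-additivity moves). [difficulty: open-problem] (why it might fail: Every proof of
5·I_G2(1/3)=6·I_A2(1/3) is Opdam's evaluation (shift operators + Carlson-type continuation in k); no
coupling/Selberg reduction exists for G2 at k∉ℕ, and even granting both anchors the bare 2-torus
identity needs cancellation of a common Beta factor. May be a Neg pair.) [Macdonald1982, Opdam1989,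
ForresterWarnaar2008, doi:10.1137/0518065, doi:10.2307/2118632, doi:10.1155/s1073792804141597]
#3 G2OpdamLine (crux) — the G₂ Macdonald–Opdam evaluation as ONE exponent line in Beta normal form:
for every rational k ≥ 0, on D = ℝ² × (0,1)² the representations [D,
J·(|Δ⁺_{G₂}|²·x(1−x)·y(1−y)⁵)^k] and [D, J·(x²y⁶)^k] are KZ-equivalent
(I_{G₂}(k)·B(k+1,k+1)·B(k+1,5k+1) = (2π)²/((2k+1)(6k+1)); both weights are RATIONAL functions with
ℚ-coefficients, only the exponent k is fractional; k = 1/3 is the G₂ anchor of the sector, k ∈ ℕ is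
support G2OpdamLineNat). [difficulty: open-problem] (why it might fail: At k∉ℕ the only proof is
Opdam1989/Heckman1991: shift operators give I(k+1)/I(k)∈ℚ(k), the anchor is fixed by analytic
continuation (a 1-periodic function is constant: Carlson/asymptotics) — not a move. Integer points
and shifts accessible, rational points possibly not.) [Opdam1989, doi:10.1007/bf01239517,
Macdonald1982, AndrewsAskeyRoy1999, ForresterWarnaar2008]
#4 ShiftIsMoves (crux) — ENGINE (card item ShiftIsMoves(R), R = G₂ and A₂): for all p, q ∈ ℕ, q > 0,
k := p/q, with r = [ℝ², J·|Δ⁺_R|^{2(k+1)}], r' = [ℝ², J·|Δ⁺_R|^{2k}]: D̃·[r] − Ñ·[r'] ∈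
KZ.relations, where for G₂ Ñ = 144(2p+q)²(3p+q)(3p+2q)(6p+q)(6p+5q), D̃ =
5(p+q)²(5p+q)(5p+2q)(5p+3q)(5p+4q) and for A₂ Ñ = 3(3p+q)(3p+2q), D̃ = (p+q)² (homogenised
I(k+1)/I(k); checked against Γ at k = 0, 1/3, 1/2, 1, 5/2). Plan: Heckman's elementary shift
operators for the dihedral group of order 12 (resp. S₃) via Dunkl operators; adjointness =
Newton–Leibniz on the torus (in t-charts, cut along the hypertori α(θ) ∈ 2πℤ where |Δ⁺|^{2k} is not
differentiable; boundary terms vanish there) + reflections as unimodular changes of variables +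
integrand algebra; the norm ratio ‖P_δ‖²_k/‖1‖²_k by Pieri-type algebra. [difficulty: XL] (why it
might fail: Opdam's k→k+1 step = adjointness of an order-6 shift operator (Dunkl operators WITH
reflection terms) plus the norm of P_δ; as moves it needs cuts along the reflecting hypertori,
|θ|^(2k−1)-integrable intermediates and an algebraic (Pieri) norm ratio; no printed elementary shift
for A2 at k∉ℕ.) [Opdam1989, doi:10.1007/bf01239517, ForresterWarnaar2008, Macdonald1982,
doi:10.1090/s0002-9939-1988-0934842-5]
#5 G2HalfRational (crux) — the k = 1/2 anchor is rational (card item AlcoveHalfInteger(G₂)): [ℝ²,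
J·|Δ⁺_{G₂}|] ~ [pt, 512/5] (I_{G₂}(1/2) = (2π)²·binom(1,½)binom(3,½) = (2π)²·128/(5π²) = 512/5; in
t-coordinates the integrand is 256·|P(t)|/((1+t₀²)⁶(1+t₁²)⁴) with P = Π_α Im[(1+it₀)^a(1+it₁)^b] ∈
ℤ[t], i.e. PIECEWISE RATIONAL — a 2-dim rational-valued calibration of the alcove-dissection claim
(H)). [difficulty: L] (why it might fail: Piecewise-RATIONAL 2-dim integrand
(|P|/((1+t₀²)⁶(1+t₁²)⁴), deg P = 16) with rational total 512/5, but cellwise primitives are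
arctan/log of algebraic functions: a chain needs the unfolding engines
(LiouvilleUnfolding/CompiledSubstitutions) and a sign-cell decomposition; long, should not be
false.) [Macdonald1982, Opdam1989, KontsevichZagierPeriods2001]
#9 TorsionFree (support) — P_KZ = FormalRep ⧸ relations is torsion-free: n ≠ 0, n·c ∈ KZ.relations ⇒
c ∈ KZ.relations (same statement as route CoactionDevissage's TorsionFree,
stmt-KontsevichZagierPeriods-3169: slab-cutting of an auxiliary unit interval +
KZ.mul_mem_relations_right_holds). Used by the Assembly to divide by the integer scalars.
[difficulty: provable-now] [KontsevichZagierPeriods2001,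
Literature.NumberTheory.Transcendental.KZ.mul_mem_relations_right_holds]
#9 TorusRepsExist (support) — non-vacuity: for every rational k = p/q ≥ 0 the G₂ and A₂ torus
representations [ℝ², J·|Δ⁺_R|^{2k}] exist as KZ.IntegralRep 2 (ℚ-semialgebraic: ‖1 − e(t₀)^a
e(t₁)^b‖² is a rational function, so the graph of J·|Δ⁺|^{2p/q} is cut out by v ≥ 0 ∧ v^q·den = num;
integrable: bounded times J ∈ L¹(ℝ²)). [difficulty: provable-now] [KontsevichZagierPeriods2001,
Macdonald1982]
#9 G2WeylTwelve (support) — k = 1 calibration of the torus bookkeeping (Weyl denominator, |W(G₂)| =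
12; Macdonald1982 §1): [ℝ², J·|Δ⁺_{G₂}|²] − 12·[ℝ², J] ∈ KZ.relations — the integrand is a RATIONAL
function; expand |Δ⁺|² into characters and kill every non-constant e^{im·θ} by one Newton–Leibniz
move on the torus (rational primitive in t). [difficulty: M] [Macdonald1982, ForresterWarnaar2008]
#9 G2OpdamLineNat (support) — the INTEGER points of the G₂ Opdam line are accessible: for k ∈ ℕ the
two representations of G2OpdamLine (now with rational integrands, monoid power) are KZ-equivalent —
by G2WeylTwelve-type character expansion, or uniformly from ShiftIsMoves at integer k + Beta shifts
+ product compatibility (KZ.mul_mem_relations_right_holds) from the trivial anchor k = 0.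
[difficulty: L] [Macdonald1982, Opdam1989, doi:10.1137/0518065]
#9 SectorOfSummit (support) — the local Target is a necessary special case of the summit:
KontsevichZagierPeriods → ThirdsSector (summit ⇔ KZKernelConjecture by
Literature.NumberTheory.Transcendental.kzKernelConjecture_iff_isRational; proved as an `example` in
the planner's Sketch.lean, 6 lines). [difficulty: provable-now] [KontsevichZagierPeriods2001,
Literature.NumberTheory.Transcendental.kzKernelConjecture_iff_isRational]

TWO-LAYER PLAN. Foreseen glued splits (none filed now; k ≤ 3, depth 1): ShiftIsMoves ⇐ G2Shift →
A2Shift → ShiftIsMoves (by root system; A2Shift may instead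
fall to the CMV coupling of card matrix-model-couplings-anderson-selberg); G2OverA2 ⇐ G2ThirdAnchor
(= G2OpdamLine at k = 1/3, dimension 4) →
A2ThirdAnchor (the analogous A₂ line, I_{A₂}(k)B(k+1,k+1)B(k+1,2k+1) = (2π)²/((2k+1)(3k+1))) →
BetaCancellation (the two anchors give
5·[G₂]⊗[aux] ~ 6·[A₂]⊗[aux] with a COMMON auxiliary Beta representation after one accessible Beta
shift B(4/3,8/3) = (5/9)B(4/3,5/3);
cancelling [aux] is the integral-domain question of card integral-domain-roots-of-identities) →
G2OverA2; G2HalfRational ⇐ SignCells (CAD of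
{P = 0}) → CellPrimitivesUnfolded (arctan/log rungs of LiouvilleUnfolding) → G2HalfRational;
G2OpdamLine ⇐ G2OpdamLineNat → (a Carlson-transfer
rule, if some route ever derives one) → G2OpdamLine.

KILL CRITERIA. Every typed item here is an instance of the summit, so a REFUTATION of any of them
(an additive invariant of KZ.FormalRep vanishing on the four
move sets and not on the item's combination) refutes the H21-literal summit: close `refuted:<Decl>`
and hand the witness to route Neg — G2OverA2 is
the designated candidate (dimension 2, same domain, algebraic integrands, ratio 6/5). A certified
numerical MISMATCH in any stated constant would
mean a transcription error (all constants were checked against Γ-arithmetic and 500² torus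
quadrature at filing) — restate, do not close. If a
Selberg-type coupling for G₂ at real k turns up in print (cheapest falsifier iii),
G2OverA2/G2OpdamLine become 'coupling exists' targets and the
exceptional premise moves to F₄ (pivot: file F4OverA2Squared, data in NOTES). ShiftIsMoves proved +
G2OverA2 refuted is impossible unless the
summit is false; ShiftIsMoves stuck on integrability at small k ⇒ restate for k ≥ 1/3 (all the
sector needs).

NOT DECOMPOSED YET. The F₄, E₆, E₇, E₈ thirds identities (I_{F₄} = (972/385)·I_{A₂}², I_{E₆} =
(6561/1540)·I_{A₂}³, I_{E₇}/(2π) = (209952/17017)·I_{A₂}³,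
I_{E₈} = 2³3³³/(7²·11²·13³·17²·19·23²·29)·I_{A₂}⁴ — verified numerically) need positive-root data as
definitions (24/36/63/120 roots) and are
filed only after G2OverA2 moves; the E₈ half-integer rational value
2¹²⁷/12762726426871747168694977125 likewise. The cosets 1/4, 1/6, 2/3 of G₂;
the negative statement ¬G2OverA2 as a ranked item (route Neg may want it); the A₂ anchor in
CMV/Killip–Nenciu form (other cards); any general
Carlson-transfer rule (cards wz-resummation-coset-wall / mellin-exponent-deformation-ibp own the
wall in general — this route only files its
sharpest exceptional instance family).

CHEAPEST FALSIFIER. (i) Certified 2-dim quadrature (kit, interval arithmetic on alcove cells, 30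
digits) of I_{G₂}(1/3)/I_{A₂}(1/3) against 6/5 and of I_{G₂}(1/2)
against 512/5 — run crudely at filing (pure-python 500² midpoint rule: ratio 1.199977, I_{G₂}(1/2) =
102.39999997; Γ-arithmetic exact:
binom(2,⅓)/binom(1,⅓) = 2Γ(5/3)/Γ(8/3) = 6/5). (ii) Re-derive Ñ/D̃ from Π
binom((k+1)d_i,k+1)/binom(kd_i,k) — done, agrees to 1e-15 at five k.
(iii) LOOKUP that would demote the premise: does Habsieger 1989 (doi:10.1007/978-1-4684-0637-5_9),
Kadell 1994 (G₂^∨) or Baker–Forrester give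
a Selberg change of variables for G₂ at REAL k? ForresterWarnaar2008 pp. 7–8, 15 (read at filing)
say no: uniform proof only Opdam; G₂ at
integer k via Morris n = 3; even Dyson/Morris at real γ is 'Selberg + reflection + Carlson'.

NUMBERS. I_R(k)/(2π)^r = Π_i binom(k d_i, k) (Macdonald1982 Conj. 2.1', Opdam1989 Thm); d(G₂) = 2,
6; d(A₂) = 2, 3. CT(A₂,⅓) = 27/Γ(⅓)³ = 1.4043505;
CT(G₂,⅓) = 162/(5Γ(⅓)³) = 1.6852206; ratio 6/5. I_{G₂}(½) = 512/5; I_{A₂}(½) = 24π; I_{G₂}(1) =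
12(2π)²; I_{A₂}(1) = 6(2π)².
I_{G₂}(k+1)/I_{G₂}(k) = 144(2k+1)²(3k+1)(3k+2)(6k+1)(6k+5)/(5(k+1)²(5k+1)(5k+2)(5k+3)(5k+4)) (= 12,
21.9285, 25.4608, 33 at k = 0, ⅓, ½, 1);
I_{A₂}(k+1)/I_{A₂}(k) = 3(3k+1)(3k+2)/(k+1)² (= 6, 10.125, 11.667, 15). Opdam lines:
I_{G₂}(k)B(k+1,k+1)B(k+1,5k+1) = (2π)²/((2k+1)(6k+1)),
I_{A₂}(k)B(k+1,k+1)B(k+1,2k+1) = (2π)²/((2k+1)(3k+1)). q_R at k = ⅓: G₂ 6/5, F₄ 972/385, E₆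
6561/1540, E₇ 209952/17017 (with one factor 2π),
E₈ 2³3³³/(7²11²13³17²·19·23²·29) ≈ 40.5298. Items at open: 11 (1 target, 4 cruxes, 5 support, 1
assembly).

DEFINITION REQUESTS. None needed for the typed items (explicit products over the six G₂ roots). For
the tenure expansion: `rootTorusRep (Φ⁺ : List (Fin r → ℕ)) (k : ℚ) :
KZ.IntegralRep r` with the positive-root data of F₄, E₆, E₇, E₈ in simple-root coordinates
(Summits-side Theorems topic), to be requested when
G2OverA2 moves. Cite-facts wanted (not load-bearing for any typed item, useful for refuters' value
checks): Opdam1989 Thm (Macdonald–Opdam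
evaluation for real k ≥ 0), Carlson's theorem (AndrewsAskeyRoy1999 Thm 2.8.1).

Novelty: Searches (2026-08-15): `ledger route ls` + all 20 Theses files of the summit (no
root-system/Selberg/random-matrix route); `ledger idea list`
(cards matrix-model-couplings-anderson-selberg, selberg-amgm-fibre-cm, wz-resummation-coset-wall,
mellin-exponent-deformation-ibp read or skimmed —
none has exceptional types, k = 1/3 ratios or a torus shift engine); `lit read arxiv:0710.3981
--grep Opdam|exceptional|Garvan|Zeilberger|shift`
(pp. 6–8, 12, 15 read: status of proofs by type); `lit search --source crossref` ×9 (Heckman1991,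
Zeilberger1987, Habsieger1989, Garvan1990,
GarvanGonnet1992, Cherednik1995, KillipNenciu2004, Stembridge1988, Kadell1994 located; "Kontsevich
Zagier period conjecture Selberg integral
Macdonald": 6 hits, none joining the two — nearest Golyshev–vanStraten–Zagier
doi:10.1016/j.geomphys.2019.06.006, dimensional interpolation of
Selberg integrals, no rules); `lit search --source zbmath "Macdonald constant term conjecture
exceptional root system"` (0); `lit frontier
KontsevichZagierPeriods --since 2020` (30 rows, all MZV/motivic/odd-zeta, none on root systems);
`lit bridges KontsevichZagierPeriods --cross any`
(30 rows, none relevant); `lit galaxy search "Macdonald conjecture root systems" --star all` (0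
substring hits; pdf/panama stars saturated rc
'queued too long' on three retries — the card's own audit ran galaxy pdf 'Macdonald constant term
exceptional root systems fractional k
elementary proof', 15 hits, none on k = 1/3 ratios); local `lit search`/sear  [refs: 10.1016/j.geomphys.2019.06.006, 10.1007/bf01388841, 10.1137/0513070, 10.1007/bf01239517, 0710.3981, arxiv:0710.3981, doi:10.1016/j.geomphys.2019.06.006, doi:10.1007/bf01388841, doi:10.1137/0513070, doi:10.1007/bf01239517, Opdam1989, Macdonald1982, ForresterWarnaar2008]

Barriers (technique_class: root-system-anchors alcove-dissection subsystem-ratio): - technique_class: root-system-anchors alcove-dissection subsystem-ratio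
- Literature.Barriers.KontsevichZagierPeriods.noSemialgebraicPrimitive_inv_sub_two: engaged only by
G2HalfRational (cellwise primitives of rational functions contain arctan/log) and evaded there by
UNFOLDING the angle/logarithm into one more variable (the catalogued 'add variables' evasion,
engines of routes LiouvilleUnfolding/CompiledSubstitutions); ShiftIsMoves uses the algebraic
primitives |Δ⁺|^{2k}·(trigonometric polynomial) handed over by the shift operator, never an
antiderivative in the integration variable; no primitive at all is proposed for the k = 1/3 anchors
— that is the point of the route.
- Literature.Barriers.KontsevichZagierPeriods.kzConjecture_implies_oddZetaAlgIndep: not engaged —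
every item asserts derivability of an identity that is already a THEOREM (Opdam1989) with rational
constants; nothing here proves a number transcendental or independent; the local Target inherits
summit-strength only in the trivial direction (SectorOfSummit).
- Literature.Barriers.KontsevichZagierPeriods.kzConjecture_implies_twoPiI_log_algIndep: not engaged,
same reason (no logarithms, no independence claim; the sector is rank one over ℚ so its assembly
needs no independence input).
- Literature.Barriers.KontsevichZagierPeriods.kzConjecture_implies_ellipticPeriods_algIndep: not
engaged (Γ(1/3)³ is a CM period of the hexagonal curve, but only RATIOS with rational value are
asserted, never independence).
- Lite

History (route lifecycle, newest last):
- 2026-08-15T13:48:22Z · CLOSED retired — not-a-thesis: assembly does not conclude the sub-problem Statement (operator:999:1257524)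

sub-problem: KontsevichZagierPeriods · status: closed(retired) · opened planner-plancard-KontsevichZagierPeriods-Kont-fcbef4f7-0 2026-08-15T11:44:44Z · rev 0 · ledger route-KontsevichZagierPeriods-ExceptionalCouplings
GENERATED by the gate from the ledger (D-0016/17). Provers cite these decls: `theorem foo : Summit.KontsevichZagierPeriods.KontsevichZagierPeriods.Theses.ExceptionalCouplings.<Decl> := …` in Summits/KontsevichZagierPeriods/KontsevichZagierPeriods/Theorems/<Name>.lean.
-/

namespace Summit.KontsevichZagierPeriods.KontsevichZagierPeriods.Theses.ExceptionalCouplings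

open scoped BigOperators Topology Manifold Classical MeasureTheory ProbabilityTheory Matrix InnerProductSpace ComplexConjugate ContinuousMap
open Filter Set Function TopologicalSpace MeasureTheory

attribute [summit_statement] _root_.KontsevichZagierPeriods

open Literature Periods

/-- item stmt-KontsevichZagierPeriods-6126 · target · rank 0 · closed · moot by None · by planner
why it might fail: Local target, false iff the fixed four-move calculus misses one of these Opdam identities (then the H21-literal summit is false too, SectorOfSummit); it does NOT imply the summit and is not claimed to.
sources: KontsevichZagierPeriods2001, Macdonald1982, Opdam1989
[target] LOCAL TARGET — Conjecture 1 (kernel form) on the sector Σ: for any families ρG, ρA : ℕ →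
KZ.IntegralRep 2 with domain ℝ² and integrands J·|Δ⁺_{G₂}|^{2(j+1/3)}, J·|Δ⁺_{A₂}|^{2(j+1/3)}, every
ℤ-combination c of the [ρG j], [ρA j] with KZ.eval c = 0 lies in KZ.relations. Necessary special
case of the summit (SectorOfSummit); does not imply it. -/
@[route_item "route-KontsevichZagierPeriods-ExceptionalCouplings"]
def ThirdsSector : Prop :=
  let e : ℝ → ℂ := fun s => (1 + (s : ℂ) * Complex.I) / (1 - (s : ℂ) * Complex.I); let J : (Fin 2 → ℝ) → ℝ := fun t => 4 / ((1 + t 0 ^ 2) * (1 + t 1 ^ 2)); let AG : (Fin 2 → ℝ) → ℝ := fun t => ∏ ρ ∈ ({(1, 0), (0, 1), (1, 1), (2, 1), (3, 1), (3, 2)} : Finset (ℕ × ℕ)), ‖1 - e (t 0) ^ ρ.1 * e (t 1) ^ ρ.2‖; let AA : (Fin 2 → ℝ) → ℝ := fun t => ∏ ρ ∈ ({(1, 0), (1, 1), (2, 1)} : Finset (ℕ × ℕ)), ‖1 - e (t 0) ^ ρ.1 * e (t 1) ^ ρ.2‖; ∀ (ρG ρA : ℕ → Literature.NumberTheory.Transcendental.KZ.IntegralRep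 2), (∀ j, (ρG j).domain = Set.univ ∧ ∀ t, (ρG j).integrand t = J t * AG t ^ (2 * ((j : ℝ) + 1 / 3))) → (∀ j, (ρA j).domain = Set.univ ∧ ∀ t, (ρA j).integrand t = J t * AA t ^ (2 * ((j : ℝ) + 1 / 3))) → ∀ c ∈ AddSubgroup.closure (Set.range (fun j => Literature.NumberTheory.Transcendental.KZ.of (ρG j)) ∪ Set.range (fun j => Literature.NumberTheory.Transcendental.KZ.of (ρA j))), Literature.NumberTheory.Transcendental.KZ.eval c = 0 → c ∈ Literature.NumberTheory.Transcendental.KZ.relations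

/-- item stmt-KontsevichZagierPeriods-6127 · crux · rank 2 · closed · moot by None · by planner
why it might fail: Every proof of 5·I_G2(1/3)=6·I_A2(1/3) is Opdam's evaluation (shift operators + Carlson-type continuation in k); no coupling/Selberg reduction exists for G2 at k∉ℕ, and even granting both anchors the bare 2-torus identity needs cancellation of a common Beta factor. May be a Neg pair.
sources: Macdonald1982, Opdam1989, ForresterWarnaar2008, doi:10.1137/0518065, doi:10.2307/2118632, doi:10.1155/s1073792804141597
[crux] coupling 1/3 on one torus (card item G2OverA2): with r = [ℝ², J·|Δ⁺_{G₂}|^{2/3}] and r' =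
[ℝ², J·|Δ⁺_{A₂}|^{2/3}] (A₂ = the short roots of G₂, same torus), 5·[r] − 6·[r'] ∈ KZ.relations
(values: 5·(2π)²·162/(5Γ(1/3)³) = 6·(2π)²·27/Γ(1/3)³ ≈ 332.65; two-representation reading [ℝ²,
5J|Δ⁺_{G₂}|^{2/3}] ~ [ℝ², 6J|Δ⁺_{A₂}|^{2/3}] up to four integrand-additivity moves). [difficulty:
open-problem] -/
@[route_item "route-KontsevichZagierPeriods-ExceptionalCouplings"]
def G2OverA2 : Prop :=
  let e : ℝ → ℂ := fun s => (1 + (s : ℂ) * Complex.I) / (1 - (s : ℂ) * Complex.I); let J : (Fin 2 → ℝ) → ℝ := fun t => 4 / ((1 + t 0 ^ 2) * (1 + t 1 ^ 2)); let AG : (Fin 2 → ℝ) → ℝ := fun t => ∏ ρ ∈ ({(1, 0), (0, 1), (1, 1), (2, 1), (3, 1), (3, 2)} : Finset (ℕ × ℕ)), ‖1 - e (t 0) ^ ρ.1 * e (t 1) ^ ρ.2‖; let AA : (Fin 2 → ℝ) → ℝ := fun t => ∏ ρ ∈ ({(1, 0), (1, 1), (2, 1)} : Finset (ℕ × ℕ)),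 ‖1 - e (t 0) ^ ρ.1 * e (t 1) ^ ρ.2‖; ∀ (r r' : Literature.NumberTheory.Transcendental.KZ.IntegralRep 2), r.domain = Set.univ → (∀ t, r.integrand t = J t * AG t ^ (2 / 3 : ℝ)) → r'.domain = Set.univ → (∀ t, r'.integrand t = J t * AA t ^ (2 / 3 : ℝ)) → 5 • Literature.NumberTheory.Transcendental.KZ.of r - 6 • Literature.NumberTheory.Transcendental.KZ.of r' ∈ Literature.NumberTheory.Transcendental.KZ.relations

/-- item stmt-KontsevichZagierPeriods-6128 · crux · rank 3 · closed · moot by None · by planner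
why it might fail: At k∉ℕ the only proof is Opdam1989/Heckman1991: shift operators give I(k+1)/I(k)∈ℚ(k), the anchor is fixed by analytic continuation (a 1-periodic function is constant: Carlson/asymptotics) — not a move. Integer points and shifts accessible, rational points possibly not.
sources: Opdam1989, doi:10.1007/bf01239517, Macdonald1982, AndrewsAskeyRoy1999, ForresterWarnaar2008
[crux] the G₂ Macdonald–Opdam evaluation as ONE exponent line in Beta normal form: for every
rational k ≥ 0, on D = ℝ² × (0,1)² the representations [D, J·(|Δ⁺_{G₂}|²·x(1−x)·y(1−y)⁵)^k] and [D,
J·(x²y⁶)^k] are KZ-equivalent (I_{G₂}(k)·B(k+1,k+1)·B(k+1,5k+1) = (2π)²/((2k+1)(6k+1)); both weights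
are RATIONAL functions with ℚ-coefficients, only the exponent k is fractional; k = 1/3 is the G₂
anchor of the sector, k ∈ ℕ is support G2OpdamLineNat). [difficulty: open-problem] -/
@[route_item "route-KontsevichZagierPeriods-ExceptionalCouplings"]
def G2OpdamLine : Prop :=
  let e : ℝ → ℂ := fun s => (1 + (s : ℂ) * Complex.I) / (1 - (s : ℂ) * Complex.I); let D : Set (Fin 4 → ℝ) := {z | 0 < z 2 ∧ z 2 < 1 ∧ 0 < z 3 ∧ z 3 < 1}; let J : (Fin 4 → ℝ) → ℝ := fun z => 4 / ((1 + z 0 ^ 2) * (1 + z 1 ^ 2)); let AG : (Fin 4 → ℝ) → ℝ := fun z => ∏ ρ ∈ ({(1, 0), (0, 1), (1, 1), (2, 1), (3, 1), (3, 2)} : Finset (ℕ × ℕ)), ‖1 - e (z 0) ^ ρ.1 * e (z 1) ^ ρ.2‖; ∀ (k : ℚ), 0 ≤ k → ∀ (r r' : Literature.NumberTheory.Transcendental.KZ.IntegralRep 4), r.domain = D → (∀ z, r.integrand z = J z * (AG z ^ 2 * (z 2 * (1 - z 2)) * (z 3 * (1 - z 3) ^ 5)) ^ (k : ℝ)) →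 r'.domain = D → (∀ z, r'.integrand z = J z * (z 2 ^ 2 * z 3 ^ 6) ^ (k : ℝ)) → Literature.NumberTheory.Transcendental.KZ.Equivalent r r'

/-- item stmt-KontsevichZagierPeriods-6129 · crux · rank 4 · closed · moot by None · by planner
why it might fail: Opdam's k→k+1 step = adjointness of an order-6 shift operator (Dunkl operators WITH reflection terms) plus the norm of P_δ; as moves it needs cuts along the reflecting hypertori, |θ|^(2k−1)-integrable intermediates and an algebraic (Pieri) norm ratio; no printed elementary shift for A2 at k∉ℕ.
sources: Opdam1989, doi:10.1007/bf01239517, ForresterWarnaar2008, Macdonald1982, doi:10.1090/s0002-9939-1988-0934842-5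
[crux] ENGINE (card item ShiftIsMoves(R), R = G₂ and A₂): for all p, q ∈ ℕ, q > 0, k := p/q, with r
= [ℝ², J·|Δ⁺_R|^{2(k+1)}], r' = [ℝ², J·|Δ⁺_R|^{2k}]: D̃·[r] − Ñ·[r'] ∈ KZ.relations, where for G₂ Ñ
= 144(2p+q)²(3p+q)(3p+2q)(6p+q)(6p+5q), D̃ = 5(p+q)²(5p+q)(5p+2q)(5p+3q)(5p+4q) and for A₂ Ñ =
3(3p+q)(3p+2q), D̃ = (p+q)² (homogenised I(k+1)/I(k); checked against Γ at k = 0, 1/3, 1/2, 1, 5/2).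
Plan: Heckman's elementary shift operators for the dihedral group of order 12 (resp. S₃) via Dunkl
operators; adjointness = Newton–Leibniz on the torus (in t-charts, cut along the hypertori α(θ) ∈
2πℤ where |Δ⁺|^{2k} is not differentiable; boundary terms vanish there) + reflections as unimodular
changes of variables + integrand algebra; the norm ratio ‖P_δ‖²_k/‖1‖²_k by Pieri-type algebra.
[difficulty: XL] -/
@[route_item "route-KontsevichZagierPeriods-ExceptionalCouplings"]
def ShiftIsMoves : Prop :=
  let e : ℝ → ℂ := fun s => (1 + (s : ℂ) * Complex.I) / (1 - (s : ℂ) * Complex.I); let J : (Fin 2 → ℝ) → ℝ := fun t => 4 / ((1 + t 0 ^ 2) * (1 + t 1 ^ 2)); let AG : (Fin 2 → ℝ) → ℝ := fun t => ∏ ρ ∈ ({(1, 0), (0, 1), (1, 1), (2, 1), (3, 1), (3, 2)} : Finset (ℕ × ℕ)), ‖1 - e (t 0) ^ ρ.1 * e (t 1) ^ ρ.2‖; let AA : (Fin 2 → ℝ) → ℝ := fun t => ∏ ρ ∈ ({(1, 0), (1, 1), (2, 1)} : Finset (ℕ × ℕ)), ‖1 - e (t 0) ^ ρ.1 * e (t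 1) ^ ρ.2‖; (∀ (p q : ℕ), 0 < q → ∀ (r r' : Literature.NumberTheory.Transcendental.KZ.IntegralRep 2), r.domain = Set.univ → (∀ t, r.integrand t = J t * AG t ^ (2 * ((p : ℝ) / q + 1))) → r'.domain = Set.univ → (∀ t, r'.integrand t = J t * AG t ^ (2 * ((p : ℝ) / q))) → (5 * (p + q) ^ 2 * (5 * p + q) * (5 * p + 2 * q) * (5 * p + 3 * q) * (5 * p + 4 * q)) • Literature.NumberTheory.Transcendental.KZ.of r - (144 * (2 * p + q) ^ 2 * (3 * p + q) * (3 * p + 2 * q) * (6 * p + q) * (6 * p + 5 * q)) • Literature.NumberTheory.Transcendental.KZ.of r' ∈ Literature.NumberTheory.Transcendental.KZ.relations) ∧ (∀ (p q : ℕ), 0 < q → ∀ (r r' : Literature.NumberTheory.Transcendental.KZ.IntegralRep 2), r.domain = Set.univ → (∀ t, r.integrand t = J t * AA t ^ (2 * ((p : ℝ) / q + 1))) → r'.domain = Set.univ → (∀ t, r'.integrand t = J t * AA t ^ (2 * ((p : ℝ) / q))) → ((p + q) ^ 2) • Literature.NumberTheory.Transcendental.KZ.of r - (3 * (3 * p +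 q) * (3 * p + 2 * q)) • Literature.NumberTheory.Transcendental.KZ.of r' ∈ Literature.NumberTheory.Transcendental.KZ.relations)

/-- item stmt-KontsevichZagierPeriods-6130 · crux · rank 5 · closed · moot by None · by planner
why it might fail: Piecewise-RATIONAL 2-dim integrand (|P|/((1+t₀²)⁶(1+t₁²)⁴), deg P = 16) with rational total 512/5, but cellwise primitives are arctan/log of algebraic functions: a chain needs the unfolding engines (LiouvilleUnfolding/CompiledSubstitutions) and a sign-cell decomposition; long, should not be false.
sources: Macdonald1982, Opdam1989, KontsevichZagierPeriods2001
[crux] the k = 1/2 anchor is rational (card item AlcoveHalfInteger(G₂)): [ℝ², J·|Δ⁺_{G₂}|] ~ [pt,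
512/5] (I_{G₂}(1/2) = (2π)²·binom(1,½)binom(3,½) = (2π)²·128/(5π²) = 512/5; in t-coordinates the
integrand is 256·|P(t)|/((1+t₀²)⁶(1+t₁²)⁴) with P = Π_α Im[(1+it₀)^a(1+it₁)^b] ∈ ℤ[t], i.e.
PIECEWISE RATIONAL — a 2-dim rational-valued calibration of the alcove-dissection claim (H)).
[difficulty: L] -/
@[route_item "route-KontsevichZagierPeriods-ExceptionalCouplings"]
def G2HalfRational : Prop :=
  let e : ℝ → ℂ := fun s => (1 + (s : ℂ) * Complex.I) / (1 - (s : ℂ) * Complex.I); let J : (Fin 2 → ℝ) → ℝ := fun t => 4 / ((1 + t 0 ^ 2) * (1 + t 1 ^ 2)); let AG : (Fin 2 → ℝ) → ℝ := fun t => ∏ ρ ∈ ({(1, 0), (0, 1), (1, 1), (2, 1), (3, 1), (3, 2)} : Finset (ℕ × ℕ)), ‖1 - e (t 0) ^ ρ.1 * e (t 1) ^ ρ.2‖; ∀ (r : Literature.NumberTheory.Transcendental.KZ.IntegralRep 2) (r' : Literature.NumberTheory.Transcendental.KZ.IntegralRep 0), r.domain = Set.univ → (∀ t, r.integrand t = J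 t * AG t) → r'.domain = Set.univ → (∀ x, r'.integrand x = 512 / 5) → Literature.NumberTheory.Transcendental.KZ.Equivalent r r'

/-- item stmt-KontsevichZagierPeriods-3169 · support · rank 9 · closed · proved by Summit.KontsevichZagierPeriods.CoactionDevissage.TorsionFree.exceptionalCouplings_torsionFree_proof @ f648441f8c8f (prover) · by planner
sources: KontsevichZagierPeriods2001, Literature.NumberTheory.Transcendental.KZ.mul_mem_relations_right_holds
[support] P_KZ is torsion-free: n ≠ 0, n • c ∈ KZ.relations ⇒ c ∈ KZ.relations. Proof: c − c·[0,1] ∈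
relations (Newton–Leibniz on each generator r with base r, band r.domain × [0,1] = (r.prod
I₀₁).domain, F(x,t) = t·f(x)); c·[0,1] − n • (c·[0,1/n]) ∈ relations (domain additivity into n slabs
over the null overlaps r.domain × {k/n}, translations t ↦ t − k/n as changes of variables); n •
(c·[0,1/n]) = (n • c)·[0,1/n] ∈ relations by `KZ.mul_mem_relations_right_holds`. Card item D0.
[difficulty: provable-now] -/
@[route_item "route-KontsevichZagierPeriods-ExceptionalCouplings"]
def TorsionFree : Prop :=
  ∀ (n : ℕ) (c : Literature.NumberTheory.Transcendental.KZ.FormalRep), n ≠ 0 → n • c ∈ Literature.NumberTheory.Transcendental.KZ.relations → c ∈ Literature.NumberTheory.Transcendental.KZ.relations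

/-- item stmt-KontsevichZagierPeriods-6131 · support · rank 9 · closed · moot by None · by planner
sources: KontsevichZagierPeriods2001, Macdonald1982
[support] non-vacuity: for every rational k = p/q ≥ 0 the G₂ and A₂ torus representations [ℝ²,
J·|Δ⁺_R|^{2k}] exist as KZ.IntegralRep 2 (ℚ-semialgebraic: ‖1 − e(t₀)^a e(t₁)^b‖² is a rational
function, so the graph of J·|Δ⁺|^{2p/q} is cut out by v ≥ 0 ∧ v^q·den = num; integrable: bounded
times J ∈ L¹(ℝ²)). [difficulty: provable-now] -/
@[route_item "route-KontsevichZagierPeriods-ExceptionalCouplings"]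
def TorusRepsExist : Prop :=
  let e : ℝ → ℂ := fun s => (1 + (s : ℂ) * Complex.I) / (1 - (s : ℂ) * Complex.I); let J : (Fin 2 → ℝ) → ℝ := fun t => 4 / ((1 + t 0 ^ 2) * (1 + t 1 ^ 2)); let AG : (Fin 2 → ℝ) → ℝ := fun t => ∏ ρ ∈ ({(1, 0), (0, 1), (1, 1), (2, 1), (3, 1), (3, 2)} : Finset (ℕ × ℕ)), ‖1 - e (t 0) ^ ρ.1 * e (t 1) ^ ρ.2‖; let AA : (Fin 2 → ℝ) → ℝ := fun t => ∏ ρ ∈ ({(1, 0), (1, 1), (2, 1)} : Finset (ℕ × ℕ)), ‖1 - e (t 0) ^ ρ.1 * e (t 1) ^ ρ.2‖; ∀ (p q : ℕ), 0 < q → (∃ r : Literature.NumberTheory.Transcendental.KZ.IntegralRep 2, r.domain = Set.univ ∧ ∀ t, r.integrand t = J t * AG t ^ (2 * ((p : ℝ) / q))) ∧ (∃ r : Literature.NumberTheory.Transcendental.KZ.IntegralRep 2, r.domain = Set.univ ∧ ∀ t, r.integrand t = J t * AA t ^ (2 * ((p : ℝ) / q)))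

/-- item stmt-KontsevichZagierPeriods-6132 · support · rank 9 · closed · moot by None · by planner
sources: Macdonald1982, ForresterWarnaar2008
[support] k = 1 calibration of the torus bookkeeping (Weyl denominator, |W(G₂)| = 12; Macdonald1982
§1): [ℝ², J·|Δ⁺_{G₂}|²] − 12·[ℝ², J] ∈ KZ.relations — the integrand is a RATIONAL function; expand
|Δ⁺|² into characters and kill every non-constant e^{im·θ} by one Newton–Leibniz move on the torus
(rational primitive in t). [difficulty: M] -/
@[route_item "route-KontsevichZagierPeriods-ExceptionalCouplings"]
def G2WeylTwelve : Prop :=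
  let e : ℝ → ℂ := fun s => (1 + (s : ℂ) * Complex.I) / (1 - (s : ℂ) * Complex.I); let J : (Fin 2 → ℝ) → ℝ := fun t => 4 / ((1 + t 0 ^ 2) * (1 + t 1 ^ 2)); let AG : (Fin 2 → ℝ) → ℝ := fun t => ∏ ρ ∈ ({(1, 0), (0, 1), (1, 1), (2, 1), (3, 1), (3, 2)} : Finset (ℕ × ℕ)), ‖1 - e (t 0) ^ ρ.1 * e (t 1) ^ ρ.2‖; ∀ (r r₀ : Literature.NumberTheory.Transcendental.KZ.IntegralRep 2), r.domain = Set.univ → (∀ t, r.integrand t = J t * AG t ^ 2) → r₀.domain = Set.univ → (∀ t, r₀.integrand t = J t) → Literature.NumberTheory.Transcendental.KZ.of r - 12 • Literature.NumberTheory.Transcendental.KZ.of r₀ ∈ Literature.NumberTheory.Transcendental.KZ.relations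

/-- item stmt-KontsevichZagierPeriods-6133 · support · rank 9 · closed · moot by None · by planner
sources: Macdonald1982, Opdam1989, doi:10.1137/0518065
[support] the INTEGER points of the G₂ Opdam line are accessible: for k ∈ ℕ the two representations
of G2OpdamLine (now with rational integrands, monoid power) are KZ-equivalent — by G2WeylTwelve-type
character expansion, or uniformly from ShiftIsMoves at integer k + Beta shifts + product
compatibility (KZ.mul_mem_relations_right_holds) from the trivial anchor k = 0. [difficulty: L] -/
@[route_item "route-KontsevichZagierPeriods-ExceptionalCouplings"]
def G2OpdamLineNat : Prop :=
  let e : ℝ → ℂ := fun s => (1 + (s : ℂ) * Complex.I) / (1 - (s : ℂ) * Complex.I); let D : Set (Fin 4 → ℝ) := {z | 0 < z 2 ∧ z 2 < 1 ∧ 0 < z 3 ∧ z 3 < 1}; let J : (Fin 4 → ℝ) → ℝ := fun z => 4 / ((1 + z 0 ^ 2) * (1 + z 1 ^ 2)); let AG : (Fin 4 → ℝ) → ℝ := fun z => ∏ ρ ∈ ({(1, 0), (0, 1), (1, 1), (2, 1), (3, 1), (3, 2)} : Finset (ℕ × ℕ)), ‖1 - e (z 0) ^ ρ.1 * e (z 1)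 ^ ρ.2‖; ∀ (k : ℕ) (r r' : Literature.NumberTheory.Transcendental.KZ.IntegralRep 4), r.domain = D → (∀ z, r.integrand z = J z * (AG z ^ 2 * (z 2 * (1 - z 2)) * (z 3 * (1 - z 3) ^ 5)) ^ k) → r'.domain = D → (∀ z, r'.integrand z = J z * (z 2 ^ 2 * z 3 ^ 6) ^ k) → Literature.NumberTheory.Transcendental.KZ.Equivalent r r'

/-- item stmt-KontsevichZagierPeriods-6134 · support · rank 9 · closed · moot by None · by planner
sources: KontsevichZagierPeriods2001, Literature.NumberTheory.Transcendental.kzKernelConjecture_iff_isRational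
[support] the local Target is a necessary special case of the summit: KontsevichZagierPeriods →
ThirdsSector (summit ⇔ KZKernelConjecture by
Literature.NumberTheory.Transcendental.kzKernelConjecture_iff_isRational; proved as an `example` in
the planner's Sketch.lean, 6 lines). [difficulty: provable-now] -/
@[route_item "route-KontsevichZagierPeriods-ExceptionalCouplings"]
def SectorOfSummit : Prop :=
  KontsevichZagierPeriods → ThirdsSector

/-- item stmt-KontsevichZagierPeriods-6135 · assembly · rank 1 · closed · moot by None · by planner
sources: KontsevichZagierPeriods2001, Opdam1989
[assembly] G2OverA2 → ShiftIsMoves → TorsionFree → ThirdsSector. -/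
@[route_item "route-KontsevichZagierPeriods-ExceptionalCouplings"]
def Assembly : Prop :=
  G2OverA2 → ShiftIsMoves → TorsionFree → ThirdsSector

end Summit.KontsevichZagierPeriods.KontsevichZagierPeriods.Theses.ExceptionalCouplings
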